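import Summits.Ventures.QEC.Thresholds.HypergraphProductFamilyThresholds
import Summits.Ventures.QEC.Thresholds.PhenomenologicalBoxThresholds
import HarnessLib

/-!
# Hypergraph-product families: two-rate phenomenological threshold BOXES `p₀(c₁ + q₂ + 1)` — UNCONDITIONAL

Venture QEC, `Summits/Ventures/QEC/Thresholds/` (LADDER-QEC rung Q5 × census HGP objects; qec-type-09 gen 4, item 09.ANISO;
continues `HypergraphProductFamilyThresholds.lean`, whose phenomenological rows `hgp_z_phenom_isThresholdLowerBound` /
`hgp_x_…` are for `q = p`). With the two-rate machinery (`PhenomenologicalBoxThresholds.lean`,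
`CSSFamilyAnisotropicThresholds.lean`) the same hypotheses — seed row/column weights `c₁, q₂` (resp. `q₁, c₂`), sector
distances `≥ d i ≥ 1` via Tillich–Zémor, space-time growth `(n₁n₂ + m₁m₂ + m₁n₂)·T i·r^{d i} → 0` — certify the whole
SQUARE `0 ≤ p, q < p₀(c₁ + q₂ + 1)` of (qubit rate, measurement rate) pairs, for every minimum-weight space-time decoder
family. All UNCONDITIONAL, tier CERTIFIED (kernel), axioms standard, 0 facts:

* `hgp_z_phenom_isThresholdBoxLowerBound` — `IsThresholdBoxLowerBound (zPhenomFailureFamily₂ (HGP.code …) T D) (p₀(c₁+q₂+1))`;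
* `hgp_x_phenom_isThresholdBoxLowerBound` — the `X`-sector twin with `p₀(q₁+c₂+1)`.

## References
* [DumerKovalevPryadko2015] I. Dumer, A. A. Kovalev, L. P. Pryadko, PRL 115 (2015) 050502, Thm 3, p. 5 (w → w + 2).
* [TillichZemor2014] J.-P. Tillich, G. Zémor, IEEE Trans. Inform. Theory 60 (2014) 1193, Thm 9 (sector distances).
-/

noncomputable section

namespace Summit.Ventures.QEC.Thresholds

open Filter Topology Finset Matrix
open Literature.InformationTheory.QuantumCodes
open Literature.InformationTheory.Coding (minDist)

section Family

variable {m₁ n₁ m₂ n₂ : ℕ → ℕ}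

/-- **`Z`-sector two-rate threshold box of an HGP family `≥ p₀(c₁ + q₂ + 1)`**: qubit rate `p`, measurement rate `q`,
every `0 ≤ p, q < p₀(c₁+q₂+1)` below threshold (`T i` rounds, ANY minimum-weight space-time decoders; hypotheses as in
`hgp_z_phenom_isThresholdLowerBound`). UNCONDITIONAL. [cite: DumerKovalevPryadko2015, Thm 3 with p. 5 (w → w + 2)] -/
theorem hgp_z_phenom_isThresholdBoxLowerBound (H₁ : ∀ i, Matrix (Fin (m₁ i)) (Fin (n₁ i)) (ZMod 2))
    (H₂ : ∀ i, Matrix (Fin (m₂ i)) (Fin (n₂ i)) (ZMod 2)) (T : ℕ → ℕ)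
    (D : ∀ i, CSSPhenom.STDecoder (Fin (m₁ i) × Fin (n₂ i))
      ((Fin (n₁ i) × Fin (n₂ i)) ⊕ (Fin (m₁ i) × Fin (m₂ i))) (T i))
    (hD : ∀ i, (D i).IsMinWeight (CSSPhenom.stSyn (HGP.code (H₁ i) (H₂ i)).HX (T i))
      (CSSPhenom.stCycles (HGP.code (H₁ i) (H₂ i)).HX (T i)) hammingNorm)
    {c₁ q₂ : ℕ} (h₁ : ∀ i a, hammingNorm (H₁ i a) ≤ c₁)
    (h₂ : ∀ i j, hammingNorm (fun b => H₂ i b j) ≤ q₂) (d : ℕ → ℕ) (hd1 : ∀ i, 1 ≤ d i)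
    (hd₁ : ∀ i, (d i : ℕ∞) ≤ minDist (pcCode (H₁ i))) (hd₂ : ∀ i, (d i : ℕ∞) ≤ minDist (pcCode (H₂ i)ᵀ))
    (hgrowth : ∀ r : ℝ, 0 < r → r < 1 →
      Tendsto (fun i => (((n₁ i * n₂ i + m₁ i * m₂ i + m₁ i * n₂ i) * T i : ℕ) : ℝ) * r ^ d i)
        atTop (𝓝 0)) :
    IsThresholdBoxLowerBound (zPhenomFailureFamily₂ (fun i => HGP.code (H₁ i) (H₂ i)) T D)
      (thresholdValue ((c₁ + q₂ + 1 : ℕ) : ℝ)) := by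
  refine z_phenom_isThresholdBoxLowerBound_of_rowWeight _ T D hD
    (fun i x => hgp_card_rowSupp_HX_le _ _ (h₁ i) (h₂ i) x) d hd1
    (fun i x hx hxS => hgp_le_weight_zLogical _ _ (hd₁ i) (hd₂ i) x hx hxS) fun r hr0 hr1 => ?_
  refine (hgrowth r hr0 hr1).congr fun i => ?_
  rw [HGP.card_qubits, Fintype.card_prod, Fintype.card_fin, Fintype.card_fin]

/-- **`X`-sector two-rate threshold box of an HGP family `≥ p₀(q₁ + c₂ + 1)`**. UNCONDITIONAL.
[cite: DumerKovalevPryadko2015, Thm 3 with p. 5 (w → w + 2)] -/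
theorem hgp_x_phenom_isThresholdBoxLowerBound (H₁ : ∀ i, Matrix (Fin (m₁ i)) (Fin (n₁ i)) (ZMod 2))
    (H₂ : ∀ i, Matrix (Fin (m₂ i)) (Fin (n₂ i)) (ZMod 2)) (T : ℕ → ℕ)
    (D : ∀ i, CSSPhenom.STDecoder (Fin (n₁ i) × Fin (m₂ i))
      ((Fin (n₁ i) × Fin (n₂ i)) ⊕ (Fin (m₁ i) × Fin (m₂ i))) (T i))
    (hD : ∀ i, (D i).IsMinWeight (CSSPhenom.stSyn (HGP.code (H₁ i) (H₂ i)).HZ (T i))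
      (CSSPhenom.stCycles (HGP.code (H₁ i) (H₂ i)).HZ (T i)) hammingNorm)
    {q₁ c₂ : ℕ} (h₁ : ∀ i j, hammingNorm (fun a => H₁ i a j) ≤ q₁)
    (h₂ : ∀ i b, hammingNorm (H₂ i b) ≤ c₂) (d : ℕ → ℕ) (hd1 : ∀ i, 1 ≤ d i)
    (hd₁ : ∀ i, (d i : ℕ∞) ≤ minDist (pcCode (H₁ i)ᵀ)) (hd₂ : ∀ i, (d i : ℕ∞) ≤ minDist (pcCode (H₂ i)))
    (hgrowth : ∀ r : ℝ, 0 < r → r < 1 →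
      Tendsto (fun i => (((n₁ i * n₂ i + m₁ i * m₂ i + n₁ i * m₂ i) * T i : ℕ) : ℝ) * r ^ d i)
        atTop (𝓝 0)) :
    IsThresholdBoxLowerBound (xPhenomFailureFamily₂ (fun i => HGP.code (H₁ i) (H₂ i)) T D)
      (thresholdValue ((q₁ + c₂ + 1 : ℕ) : ℝ)) := by
  refine x_phenom_isThresholdBoxLowerBound_of_rowWeight _ T D hD
    (fun i x => hgp_card_rowSupp_HZ_le _ _ (h₁ i) (h₂ i) x) d hd1
    (fun i x hx hxS => hgp_le_weight_xLogical _ _ (hd₁ i) (hd₂ i) x hx hxS) fun r hr0 hr1 => ?_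
  refine (hgrowth r hr0 hr1).congr fun i => ?_
  rw [HGP.card_qubits, Fintype.card_prod, Fintype.card_fin, Fintype.card_fin]

end Family

end Summit.Ventures.QEC.Thresholds

end
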